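import Summits.BirchSwinnertonDyer.Rank1Residual.X11b.Three.CompletedGaloisAction
import Summits.BirchSwinnertonDyer.Rank1Residual.X11b.FrameIdealRigidity
import Summits.BirchSwinnertonDyer.Rank1Residual.X11b.BDPRouteIntSeriesContinuity
import HarnessLib

/-!
# X11b @ `p = 3`, S29 K4-B: the exponent cocycle of a Galois-twisted integral series dies on inertia

HONEST FRAMING (cell `b2b-bsdres`, run/shared/lean/b2b/bsd-rank1-residual/, verbatim in every
file): the goal of the cell is to DELETE the COMBINATION-SHAPED residual classes of the
Birch–Swinnerton-Dyer formula for ALL analytic-rank `≤ 1` elliptic curves over `ℚ` — assembled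
STRICTLY from published theorems — so that the rank-`≤ 1` remainder becomes exactly the
CONSTRUCTION-SHAPED classes, which are TYPED, NOT attempted. This is not "finishing BSD". Team N8/O2
(X11b at `3`); deal S29 (x11b3-lead GEN 8, OWNERS R9-8/R9-21/R9-29/R9-30), package K4 (Step 2–3 =
r2's (T′)), seat `b2b-bsdres-x11b3-p7` (gen. 5). WORDING OF RECORD (H45, R9-8): S29 RE-EXPRESSES
(t) ⟸ (VR). The Galois-cohomological input enters as the EXPLICIT HYPOTHESIS `hSen` (a NAME only: NO
Sen theory is used or assumed — its content is local Kronecker–Weber at `p` + Lang's theorem in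
`R₀ˣ` + Tate's `H⁰(Γ_{ℚ_p}, ℂ_p(χ^j)) = 0`, package K3 of x11b3-p1/p2/p5, to be DISCHARGED by them);
nothing discharges it here; the node `Three.HsiehDescentAt₃` is UNCHANGED; O2 OPEN / N8 CONSTRUCTION;
nothing booked. THEOREMS ONLY (no definition, no named fact, no `sorry`); every prime `p`.

## What this file proves (plan `s25/K4-PLAN.md` Step 3 as amended = r2's (T′); `s25/K4-INTERFACES.md`)

Throughout `E ∈ 𝓞_{ℂ_p}⟦T⟧`, `Ē` its image in `ℂ_p⟦T⟧`, `B_a = (1+T)^a` (`a ∈ ℤ_p`,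
`binomialSeries`, in multr1-p1's `R1.toCpInt` currency), `T_τ` a family of continuous extensions to
`ℂ_p` of the `τ ∈ Gal(ℚ̄_p/ℚ_p)`. A TWIST RELATION for `τ` is `T_τĒ = d · B_a · Ē` (`d ∈ ℂ_pˣ`).
* `twist_unique` — for `E ≠ 0` the pair `(d, a)` of a twist relation is unique (first two non-zero
  coefficients).
* `twist_mul` — twist relations compose: exponents ADD (`B_a B_b = B_{a+b}`, `T_τ` fixes `ℚ_p`).
* `continuous_twistExponent` — if every `τ` has a twist relation with exponent `a(τ)`, then
  `τ ↦ a(τ)` is CONTINUOUS (Krull topology; orbit continuity of `τ ↦ T_τ x`).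
* `twist_divXPowOrder` — the relation descends to `E₁ = E / T^{ord E}` (`E₁(0) ≠ 0`).
* `twist_period` — PERIODS: for `w ∈ ℚ_p` with `‖w − 1‖ < ‖E₁(0)‖` and the `ℤ_p`-power character `ψ`
  of `w`, `q = E₁(w − 1)/E₁(0) ≠ 0` satisfies `T_τ q = ψ(a(τ)) · q` for every `τ` (`d` cancels).
* **`twistExponent_eq_zero_of_inertia`** — hence, GIVEN `hSen`, `a(τ) = 0` for every `τ` in the
  inertia group (`τ` fixing the prime-to-`p` roots of unity): on inertia `T_τ Ē = d_τ Ē`.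

References: r2 memo `gen12/S29-0c-QK2b-r2.md` §5 (the two-rational-points semi-invariant);
[Washington1997] §5.1 (`(1+T)^a`); [Tate1967] §3.3 (the content behind `hSen`).
-/

noncomputable section

open scoped Topology
open Filter PowerSeries Literature.NumberTheory.EllipticCurves

namespace Summit.BirchSwinnertonDyer.Rank1Residual.X11b.Three.RangeTransport

variable {p : ℕ} [Fact p.Prime]

/-! ### §1. Binomial twists in `ℂ_p⟦T⟧` -/

/-- `[T^k](1+T)^a`, read in `ℂ_p`, is the image of `C(a,k) ∈ ℤ_p ⊂ ℚ_p`. [cite: Washington1997, §5.1] -/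
theorem coe_coeff_binomialTwist (a : ℤ_[p]) (k : ℕ) :
    ((coeff k ((binomialSeries ℤ_[p] a).map (R1.toCpInt p)) : 𝓞_ℂ_[p]) : ℂ_[p]) =
      algebraMap ℚ_[p] ℂ_[p] ((Ring.choose a k : ℤ_[p]) : ℚ_[p]) := by
  rw [coeff_map, binomialSeries_coeff, smul_eq_mul, mul_one, R1.coe_toCpInt]

/-- `[T⁰](1+T)^a = 1` in `ℂ_p`. [cite: Washington1997, §5.1] -/
theorem coe_coeff_zero_binomialTwist (a : ℤ_[p]) :
    ((coeff 0 ((binomialSeries ℤ_[p] a).map (R1.toCpInt p)) : 𝓞_ℂ_[p]) : ℂ_[p]) = 1 := by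
  rw [coe_coeff_binomialTwist, Ring.choose_zero_right]; simp

/-- `(1+T)^a` has constant term `1` (in `ℂ_p`). [cite: Washington1997, §5.1] -/
theorem coe_constantCoeff_binomialTwist (a : ℤ_[p]) :
    ((constantCoeff ((binomialSeries ℤ_[p] a).map (R1.toCpInt p)) : 𝓞_ℂ_[p]) : ℂ_[p]) = 1 := by
  rw [← coeff_zero_eq_constantCoeff_apply, coe_coeff_zero_binomialTwist]

/-- `[T¹](1+T)^a = a` in `ℂ_p`. [cite: Washington1997, §5.1] -/
theorem coe_coeff_one_binomialTwist (a : ℤ_[p]) :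
    ((coeff 1 ((binomialSeries ℤ_[p] a).map (R1.toCpInt p)) : 𝓞_ℂ_[p]) : ℂ_[p]) =
      algebraMap ℚ_[p] ℂ_[p] ((a : ℤ_[p]) : ℚ_[p]) := by
  rw [coe_coeff_binomialTwist, Ring.choose_one_right]

/-- A continuous extension `T` of some `τ ∈ Gal(ℚ̄_p/ℚ_p)` fixes `ℚ_p ⊂ ℂ_p`. [folklore] -/
theorem extension_algebraMap' {τ : PadicAlgCl p ≃ₐ[ℚ_[p]] PadicAlgCl p} {T : ℂ_[p] →+* ℂ_[p]}
    (hTτ : ∀ x : PadicAlgCl p, T x = τ x) (q : ℚ_[p]) :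
    T (algebraMap ℚ_[p] ℂ_[p] q) = algebraMap ℚ_[p] ℂ_[p] q := by
  rw [IsScalarTower.algebraMap_apply ℚ_[p] (PadicAlgCl p) ℂ_[p], ← PadicComplex.coe_eq,
    extension_algebraMap hTτ]

/-- `T` fixes the binomial series `(1+T)^a` (coefficients in `ℚ_p`). [folklore] -/
theorem map_extension_binomialTwist {τ : PadicAlgCl p ≃ₐ[ℚ_[p]] PadicAlgCl p}
    {T : ℂ_[p] →+* ℂ_[p]} (hTτ : ∀ x : PadicAlgCl p, T x = τ x) (a : ℤ_[p]) :
    (((binomialSeries ℤ_[p] a).map (R1.toCpInt p)).map (PadicComplexInt p).subtype).map T =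
      ((binomialSeries ℤ_[p] a).map (R1.toCpInt p)).map (PadicComplexInt p).subtype := by
  ext k
  rw [coeff_map, coeff_map, ValuationSubring.subtype_apply, coe_coeff_binomialTwist,
    extension_algebraMap' hTτ]

/-- The image `Ē ∈ ℂ_p⟦T⟧` of `E ∈ 𝓞_{ℂ_p}⟦T⟧` vanishes iff `E` does. [folklore] -/
theorem map_subtype_eq_zero_iff {E : PowerSeries 𝓞_ℂ_[p]} :
    E.map (PadicComplexInt p).subtype = 0 ↔ E = 0 := by
  constructor
  · intro h
    exact map_injective _ Subtype.coe_injective (by rw [h, map_zero])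
  · rintro rfl; rw [map_zero]

/-- Low coefficients of a product in `ℂ_p⟦T⟧`: `[T⁰](BG) = B₀G₀`, `[T¹](BG) = B₀G₁ + B₁G₀`.
[folklore] -/
theorem coeff_zero_one_mul (B G : PowerSeries ℂ_[p]) :
    coeff 0 (B * G) = coeff 0 B * coeff 0 G ∧
      coeff 1 (B * G) = coeff 0 B * coeff 1 G + coeff 1 B * coeff 0 G := by
  refine ⟨by rw [coeff_mul, Finset.Nat.antidiagonal_zero, Finset.sum_singleton], ?_⟩
  have hB := eq_X_mul_shift_add_const B
  conv_lhs => rw [hB]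
  rw [add_mul, map_add, mul_assoc, coeff_succ_X_mul, coeff_mul, Finset.Nat.antidiagonal_zero,
    Finset.sum_singleton, coeff_mk, zero_add, ← coeff_zero_eq_constantCoeff_apply, coeff_C_mul]
  ring

/-- The two lowest coefficients of `B · F` above the order `m` of `F`:
`[T^m](BF) = B₀·[T^m]F` and `[T^{m+1}](BF) = B₀·[T^{m+1}]F + B₁·[T^m]F`. [folklore] -/
theorem coeff_order_mul (B F : PowerSeries ℂ_[p]) :
    coeff F.order.toNat (B * F) = coeff 0 B * coeff F.order.toNat F ∧
      coeff (F.order.toNat + 1) (B * F) =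
        coeff 0 B * coeff (F.order.toNat + 1) F + coeff 1 B * coeff F.order.toNat F := by
  set m := F.order.toNat with hm
  set F₁ := F.divXPowOrder with hF₁
  have hF : F = X ^ m * F₁ := (X_pow_order_mul_divXPowOrder (f := F)).symm
  have hcomm : B * (X ^ m * F₁) = X ^ m * (B * F₁) := by ring
  have h0 : ∀ G : PowerSeries ℂ_[p], coeff m (X ^ m * G) = coeff 0 G := fun G ↦ by
    rw [coeff_X_pow_mul', if_pos le_rfl, Nat.sub_self]
  have h1 : ∀ G : PowerSeries ℂ_[p], coeff (m + 1) (X ^ m * G) = coeff 1 G := fun G ↦ by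
    rw [coeff_X_pow_mul', if_pos (Nat.le_succ m), Nat.add_sub_cancel_left]
  obtain ⟨hz, ho⟩ := coeff_zero_one_mul B F₁
  rw [hF, hcomm, h0, h0, h1, h1, hz, ho]
  exact ⟨rfl, rfl⟩

/-- The two lowest coefficients of `B_a · Ē` above the order `m` of `Ē`: `[T^m] = [T^m]Ē` and
`[T^{m+1}] = [T^{m+1}]Ē + a·[T^m]Ē`. [cite: Washington1997, §5.1] -/
theorem coeff_order_binomialTwist_mul (a : ℤ_[p]) (F : PowerSeries ℂ_[p]) :
    coeff F.order.toNat ((((binomialSeries ℤ_[p] a).map (R1.toCpInt p)).map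
        (PadicComplexInt p).subtype) * F) = coeff F.order.toNat F ∧
    coeff (F.order.toNat + 1) ((((binomialSeries ℤ_[p] a).map (R1.toCpInt p)).map
        (PadicComplexInt p).subtype) * F) =
      coeff (F.order.toNat + 1) F + algebraMap ℚ_[p] ℂ_[p] ((a : ℤ_[p]) : ℚ_[p]) *
        coeff F.order.toNat F := by
  set B := ((binomialSeries ℤ_[p] a).map (R1.toCpInt p)).map (PadicComplexInt p).subtype with hB
  have hB0 : coeff 0 B = 1 := by
    rw [hB, coeff_map, ValuationSubring.subtype_apply, coe_coeff_zero_binomialTwist]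
  have hB1 : coeff 1 B = algebraMap ℚ_[p] ℂ_[p] ((a : ℤ_[p]) : ℚ_[p]) := by
    rw [hB, coeff_map, ValuationSubring.subtype_apply, coe_coeff_one_binomialTwist]
  obtain ⟨h0, h1⟩ := coeff_order_mul B F
  rw [h0, h1, hB0, hB1, one_mul, one_mul]
  exact ⟨rfl, rfl⟩

/-- **Uniqueness of a twist relation.** If `E ≠ 0` and `d·B_a·Ē = d'·B_{a'}·Ē` in `ℂ_p⟦T⟧` with
`d ≠ 0`, then `d = d'` and `a = a'`. [cite: Washington1997, §5.1] -/
theorem twist_unique {E : PowerSeries 𝓞_ℂ_[p]} (hE : E ≠ 0) {a a' : ℤ_[p]} {d d' : ℂ_[p]}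
    (hd : d ≠ 0)
    (h : C d * ((((binomialSeries ℤ_[p] a).map (R1.toCpInt p)) * E).map (PadicComplexInt p).subtype) =
      C d' * ((((binomialSeries ℤ_[p] a').map (R1.toCpInt p)) * E).map (PadicComplexInt p).subtype)) :
    d = d' ∧ a = a' := by
  set F := E.map (PadicComplexInt p).subtype with hF
  have hF0 : F ≠ 0 := fun h0 ↦ hE (map_subtype_eq_zero_iff.1 h0)
  have he : coeff F.order.toNat F ≠ 0 := coeff_order hF0
  rw [map_mul, map_mul] at h
  obtain ⟨h0, h1⟩ := coeff_order_binomialTwist_mul a F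
  obtain ⟨h0', h1'⟩ := coeff_order_binomialTwist_mul a' F
  have hm := congrArg (coeff F.order.toNat) h
  rw [coeff_C_mul, coeff_C_mul, h0, h0'] at hm
  have hdd : d = d' := mul_right_cancel₀ he hm
  refine ⟨hdd, ?_⟩
  have hm1 := congrArg (coeff (F.order.toNat + 1)) h
  rw [coeff_C_mul, coeff_C_mul, h1, h1', ← hdd] at hm1
  have h2 : algebraMap ℚ_[p] ℂ_[p] ((a : ℤ_[p]) : ℚ_[p]) * coeff F.order.toNat F =
      algebraMap ℚ_[p] ℂ_[p] ((a' : ℤ_[p]) : ℚ_[p]) * coeff F.order.toNat F := by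
    have := mul_left_cancel₀ hd hm1
    exact add_left_cancel this
  have h3 := mul_right_cancel₀ he h2
  exact Subtype.coe_injective ((algebraMap ℚ_[p] ℂ_[p]).injective h3)

/-- **Twist relations compose, exponents add.** If `T₂Ē = d₂ B_{a₂} Ē` and `T₁Ē = d₁ B_{a₁} Ē`
(`T₁` an extension of some `τ₁`), then `T₁(T₂Ē) = (T₁d₂ · d₁) B_{a₁ + a₂} Ē`. [folklore] -/
theorem twist_mul {τ₁ : PadicAlgCl p ≃ₐ[ℚ_[p]] PadicAlgCl p} {T₁ T₂ : ℂ_[p] →+* ℂ_[p]}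
    (hT₁τ : ∀ x : PadicAlgCl p, T₁ x = τ₁ x) {E : PowerSeries 𝓞_ℂ_[p]} {a₁ a₂ : ℤ_[p]}
    {d₁ d₂ : ℂ_[p]}
    (h₁ : (E.map (PadicComplexInt p).subtype).map T₁ =
      C d₁ * ((((binomialSeries ℤ_[p] a₁).map (R1.toCpInt p)) * E).map (PadicComplexInt p).subtype))
    (h₂ : (E.map (PadicComplexInt p).subtype).map T₂ =
      C d₂ * ((((binomialSeries ℤ_[p] a₂).map (R1.toCpInt p)) * E).map (PadicComplexInt p).subtype)) :
    ((E.map (PadicComplexInt p).subtype).map T₂).map T₁ =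
      C (T₁ d₂ * d₁) *
        ((((binomialSeries ℤ_[p] (a₁ + a₂)).map (R1.toCpInt p)) * E).map (PadicComplexInt p).subtype) := by
  rw [h₂, map_mul, map_C, map_mul, map_mul, map_extension_binomialTwist hT₁τ, h₁, binomialSeries_add,
    map_mul, map_mul, map_mul, map_mul, map_mul]
  ring

/-! ### §2. Continuity of the exponent -/

/-- `ℤ_p → ℂ_p` is an isometry. [folklore] -/
theorem isometry_padicInt_padicComplex :
    Isometry fun a : ℤ_[p] ↦ algebraMap ℚ_[p] ℂ_[p] ((a : ℤ_[p]) : ℚ_[p]) := by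
  refine Isometry.of_dist_eq fun a b ↦ ?_
  rw [dist_eq_norm, dist_eq_norm, ← map_sub, norm_algebraMap', ← PadicInt.coe_sub,
    PadicInt.padic_norm_e_of_padicInt]

/-- **Continuity of the twist exponent.** If every `τ ∈ Gal(ℚ̄_p/ℚ_p)` has a twist relation
`T_τĒ = d(τ) B_{a(τ)} Ē` for a non-zero `E` (with `T_τ` continuous extensions), then `τ ↦ a(τ)` is
continuous: `a(τ)` is a rational function of `T_τ e₀, T_τ e₁` for the two lowest coefficients
`e₀ ≠ 0, e₁` of `E`, and orbits are continuous. [folklore] -/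
theorem continuous_twistExponent (T : (PadicAlgCl p ≃ₐ[ℚ_[p]] PadicAlgCl p) → ℂ_[p] →+* ℂ_[p])
    (hT : ∀ τ, Continuous (T τ)) (hTτ : ∀ τ (x : PadicAlgCl p), T τ x = τ x)
    {E : PowerSeries 𝓞_ℂ_[p]} (hE : E ≠ 0) {a : (PadicAlgCl p ≃ₐ[ℚ_[p]] PadicAlgCl p) → ℤ_[p]}
    {d : (PadicAlgCl p ≃ₐ[ℚ_[p]] PadicAlgCl p) → ℂ_[p]}
    (h : ∀ τ, (E.map (PadicComplexInt p).subtype).map (T τ) =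
      C (d τ) * ((((binomialSeries ℤ_[p] (a τ)).map (R1.toCpInt p)) * E).map
        (PadicComplexInt p).subtype)) :
    Continuous a := by
  set F := E.map (PadicComplexInt p).subtype with hF
  have hF0 : F ≠ 0 := fun h0 ↦ hE (map_subtype_eq_zero_iff.1 h0)
  set m := F.order.toNat with hm
  set e₀ := coeff m F with he₀
  set e₁ := coeff (m + 1) F with he₁
  have he : e₀ ≠ 0 := coeff_order hF0
  -- the two coefficient identities
  have hid : ∀ τ, T τ e₀ = d τ * e₀ ∧
      T τ e₁ = d τ * (e₁ + algebraMap ℚ_[p] ℂ_[p] ((a τ : ℤ_[p]) : ℚ_[p]) * e₀) := by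
    intro τ
    obtain ⟨h0, h1⟩ := coeff_order_binomialTwist_mul (a τ) F
    have hτ := h τ
    rw [map_mul] at hτ
    refine ⟨?_, ?_⟩
    · have := congrArg (coeff m) hτ
      rwa [coeff_map, coeff_C_mul, h0] at this
    · have := congrArg (coeff (m + 1)) hτ
      rwa [coeff_map, coeff_C_mul, h1] at this
  have hTe : ∀ τ, T τ e₀ ≠ 0 := fun τ h0 ↦ by
    have : ‖e₀‖ = 0 := by rw [← norm_extension (hT τ) (hTτ τ) e₀, h0, norm_zero]
    exact he (norm_eq_zero.1 this)
  -- `a(τ)` as a rational function of the orbits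
  have hformula : ∀ τ, algebraMap ℚ_[p] ℂ_[p] ((a τ : ℤ_[p]) : ℚ_[p]) =
      (T τ e₁ * e₀ - T τ e₀ * e₁) / (T τ e₀ * e₀) := by
    intro τ
    obtain ⟨h0, h1⟩ := hid τ
    rw [eq_div_iff (mul_ne_zero (hTe τ) he), h1, h0]
    ring
  have hcont : Continuous fun τ ↦ algebraMap ℚ_[p] ℂ_[p] ((a τ : ℤ_[p]) : ℚ_[p]) := by
    simp_rw [hformula]
    exact (((continuous_orbit T hT hTτ e₁).mul continuous_const).sub
      ((continuous_orbit T hT hTτ e₀).mul continuous_const)).div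
      ((continuous_orbit T hT hTτ e₀).mul continuous_const) fun τ ↦ mul_ne_zero (hTe τ) he
  exact (isometry_padicInt_padicComplex (p := p)).isEmbedding.continuous_iff.2 hcont

/-! ### §3. Descent to `E₁ = E/T^m` and the periods -/

/-- The twist relation DESCENDS to `E₁ = E / T^{ord E}` (`PowerSeries.divXPowOrder`). [folklore] -/
theorem twist_divXPowOrder {T : ℂ_[p] →+* ℂ_[p]} {E : PowerSeries 𝓞_ℂ_[p]} {a : ℤ_[p]} {d : ℂ_[p]}
    (h : (E.map (PadicComplexInt p).subtype).map T =
      C d * ((((binomialSeries ℤ_[p] a).map (R1.toCpInt p)) * E).map (PadicComplexInt p).subtype)) :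
    (E.divXPowOrder.map (PadicComplexInt p).subtype).map T =
      C d * ((((binomialSeries ℤ_[p] a).map (R1.toCpInt p)) * E.divXPowOrder).map
        (PadicComplexInt p).subtype) := by
  set m := E.order.toNat with hm
  have hXm : (X : PowerSeries ℂ_[p]) ^ m ≠ 0 := pow_ne_zero _ X_ne_zero
  apply mul_left_cancel₀ hXm
  have hE : E = X ^ m * E.divXPowOrder := (X_pow_order_mul_divXPowOrder (f := E)).symm
  calc X ^ m * (E.divXPowOrder.map (PadicComplexInt p).subtype).map T
        = ((X ^ m * E.divXPowOrder).map (PadicComplexInt p).subtype).map T := by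
          rw [map_mul, map_pow, map_X, map_mul, map_pow, map_X]
    _ = C d * ((((binomialSeries ℤ_[p] a).map (R1.toCpInt p)) * (X ^ m * E.divXPowOrder)).map
          (PadicComplexInt p).subtype) := by rw [← hE, h]
    _ = X ^ m * (C d * ((((binomialSeries ℤ_[p] a).map (R1.toCpInt p)) * E.divXPowOrder).map
          (PadicComplexInt p).subtype)) := by
          rw [map_mul, map_mul, map_mul, map_pow, map_X]; ring

/-- Values of a series given coefficientwise as `d ·` another: if `[T^k]S = d · [T^k]R` in `ℂ_p` and
`R(x) = v`, then `S(x) = d v`. [folklore] -/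
theorem hasValueAt_of_coeff_eq_mul {S R : PowerSeries 𝓞_ℂ_[p]} {d x v : ℂ_[p]}
    (h : ∀ k, ((coeff k S : 𝓞_ℂ_[p]) : ℂ_[p]) = d * coeff k R) (hv : IntSeries.HasValueAt R x v) :
    IntSeries.HasValueAt S x (d * v) := by
  unfold IntSeries.HasValueAt at hv ⊢
  have hfun : (fun k : ℕ ↦ ((coeff k S : 𝓞_ℂ_[p]) : ℂ_[p]) * x ^ k) =
      fun k ↦ d * (((coeff k R : 𝓞_ℂ_[p]) : ℂ_[p]) * x ^ k) := by
    funext k; rw [h k, mul_assoc]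
  rw [hfun]
  exact hv.mul_left d

/-- **The periods.** Let `E₁ ∈ 𝓞_{ℂ_p}⟦T⟧` satisfy `TĒ₁ = d·B_a·Ē₁` for a continuous extension `T`
of some `τ`, `d ≠ 0`. For `w ∈ ℚ_p` with `‖w − 1‖ < ‖E₁(0)‖` and a continuous `ℤ_p`-power character
`ψ` of `w` (`ψ(1) = w`): the value `v = E₁(w − 1)` is non-zero and `q = v / E₁(0)` satisfies
`T q = ψ(a) · q` (the constant `d` CANCELS). [cite: Washington1997, §5.1] -/
theorem twist_period {τ : PadicAlgCl p ≃ₐ[ℚ_[p]] PadicAlgCl p} {T : ℂ_[p] →+* ℂ_[p]}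
    (hT : Continuous T) (hTτ : ∀ x : PadicAlgCl p, T x = τ x)
    {E₁ : PowerSeries 𝓞_ℂ_[p]} {a : ℤ_[p]} {d : ℂ_[p]} (hd : d ≠ 0)
    (h : (E₁.map (PadicComplexInt p).subtype).map T =
      C d * ((((binomialSeries ℤ_[p] a).map (R1.toCpInt p)) * E₁).map (PadicComplexInt p).subtype))
    {w : ℚ_[p]} (hw : ‖algebraMap ℚ_[p] ℂ_[p] w - 1‖ < ‖((constantCoeff E₁ : 𝓞_ℂ_[p]) : ℂ_[p])‖)
    {ψ : Multiplicative ℤ_[p] →* ℂ_[p]ˣ} (hψc : Continuous ψ)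
    (hψ1 : ((ψ (Multiplicative.ofAdd 1) : ℂ_[p]ˣ) : ℂ_[p]) = algebraMap ℚ_[p] ℂ_[p] w)
    {v : ℂ_[p]} (hv : IntSeries.HasValueAt E₁ (algebraMap ℚ_[p] ℂ_[p] w - 1) v) :
    v ≠ 0 ∧
      T (v / ((constantCoeff E₁ : 𝓞_ℂ_[p]) : ℂ_[p])) =
        ((ψ (Multiplicative.ofAdd a) : ℂ_[p]ˣ) : ℂ_[p]) *
          (v / ((constantCoeff E₁ : 𝓞_ℂ_[p]) : ℂ_[p])) := by
  set e := ((constantCoeff E₁ : 𝓞_ℂ_[p]) : ℂ_[p]) with he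
  set x := algebraMap ℚ_[p] ℂ_[p] w - 1 with hx
  have he1 : ‖e‖ ≤ 1 := R1.norm_coe_padicComplexInt_le_one p _
  have hx1 : ‖x‖ < 1 := hw.trans_le he1
  -- `v ≠ 0`, `e ≠ 0`
  have hve : ‖v - e‖ ≤ ‖x‖ := intSeries_norm_value_sub_constantCoeff_le hx1.le hv
  have hv0 : v ≠ 0 := by
    intro h0
    rw [h0, zero_sub, norm_neg] at hve
    exact lt_irrefl _ (hve.trans_lt hw)
  have he0 : e ≠ 0 := by
    intro h0; rw [h0, norm_zero] at hw; exact not_lt.2 (norm_nonneg _) hw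
  refine ⟨hv0, ?_⟩
  -- the coefficient map of `T` on `𝓞`, and the coefficients of `E₁^τ`
  obtain ⟨φ, hφ⟩ := exists_restrict_padicComplexInt hT hTτ
  have hcoeff : ∀ k, ((coeff k (E₁.map φ) : 𝓞_ℂ_[p]) : ℂ_[p]) =
      d * coeff k ((((binomialSeries ℤ_[p] a).map (R1.toCpInt p)) * E₁)) := by
    intro k
    have := congrArg (coeff k) h
    rw [coeff_map, coeff_map, ValuationSubring.subtype_apply, coeff_C_mul, coeff_map,
      ValuationSubring.subtype_apply] at this
    rw [coeff_map, hφ, this]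
  -- `T v = d ψ(a) v`
  have hxfix : T x = x := by rw [hx, map_sub, map_one, extension_algebraMap' hTτ]
  have hB : IntSeries.HasValueAt ((binomialSeries ℤ_[p] a).map (R1.toCpInt p)) x
      ((ψ (Multiplicative.ofAdd a) : ℂ_[p]ˣ) : ℂ_[p]) := R1.binomialUnit_hasValueAt hx1 ψ hψc hψ1 a
  have hBv := intSeries_hasValueAt_mul hx1 hB hv
  have h1 : IntSeries.HasValueAt (E₁.map φ) x (d * (((ψ (Multiplicative.ofAdd a) : ℂ_[p]ˣ) : ℂ_[p]) * v)) :=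
    hasValueAt_of_coeff_eq_mul hcoeff hBv
  have h2 : IntSeries.HasValueAt (E₁.map φ) x (T v) := hasValueAt_map_extension_of_fixed hT hφ hxfix hv
  have hTv : T v = d * (((ψ (Multiplicative.ofAdd a) : ℂ_[p]ˣ) : ℂ_[p]) * v) := h2.unique h1
  -- `T e = d e`
  have hTe : T e = d * e := by
    have h0 := hcoeff 0
    simp only [coeff_map, hφ, coeff_mul, Finset.Nat.antidiagonal_zero, Finset.sum_singleton,
      MulMemClass.coe_mul, coeff_zero_eq_constantCoeff] at h0
    simpa only [binomialSeries_constantCoeff, map_one, OneMemClass.coe_one, one_mul,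
      coe_constantCoeff_binomialTwist] using h0
  rw [map_div₀, hTv, hTe, mul_div_mul_left _ _ hd, mul_div_assoc]

/-! ### §4. The exponent dies on inertia -/

/-- **The twist exponent vanishes on inertia.** Let `E ≠ 0` in `𝓞_{ℂ_p}⟦T⟧` carry, for EVERY
`τ ∈ Gal(ℚ̄_p/ℚ_p)` (continuous extensions `T_τ`), a twist relation `T_τĒ = d(τ)·B_{a(τ)}·Ē`,
`d(τ) ≠ 0`. Then `a` is a continuous homomorphism to `ℤ_p` with the PERIODS of `twist_period`, so the
HYPOTHESIS `hSen` (K3: local Kronecker–Weber + Lang + Tate `H⁰(ℂ_p(χ^j)) = 0`, `j ≠ 0`; no Sen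
theory) forces `a(τ) = 0` for every `τ` in the inertia group (fixing all prime-to-`p` roots of
unity of `ℚ̄_p`). [cite: Tate1967, §3.3 Theorem 2] -/
theorem twistExponent_eq_zero_of_inertia
    (T : (PadicAlgCl p ≃ₐ[ℚ_[p]] PadicAlgCl p) → ℂ_[p] →+* ℂ_[p])
    (hT : ∀ τ, Continuous (T τ)) (hTτ : ∀ τ (x : PadicAlgCl p), T τ x = τ x)
    {E : PowerSeries 𝓞_ℂ_[p]} (hE : E ≠ 0) {a : (PadicAlgCl p ≃ₐ[ℚ_[p]] PadicAlgCl p) → ℤ_[p]}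
    {d : (PadicAlgCl p ≃ₐ[ℚ_[p]] PadicAlgCl p) → ℂ_[p]} (hd : ∀ τ, d τ ≠ 0)
    (h : ∀ τ, (E.map (PadicComplexInt p).subtype).map (T τ) =
      C (d τ) * ((((binomialSeries ℤ_[p] (a τ)).map (R1.toCpInt p)) * E).map
        (PadicComplexInt p).subtype))
    (hSen : ∀ a : (PadicAlgCl p ≃ₐ[ℚ_[p]] PadicAlgCl p) → ℤ_[p],
      (∀ τ₁ τ₂, a (τ₁ * τ₂) = a τ₁ + a τ₂) → Continuous a →
      (∃ δ : ℝ, 0 < δ ∧ ∀ (w : ℚ_[p]) (ψ : Multiplicative ℤ_[p] →* ℂ_[p]ˣ), Continuous ψ →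
        ((ψ (Multiplicative.ofAdd 1) : ℂ_[p]ˣ) : ℂ_[p]) = algebraMap ℚ_[p] ℂ_[p] w →
        ‖algebraMap ℚ_[p] ℂ_[p] w - 1‖ < δ →
        ∃ q : ℂ_[p], q ≠ 0 ∧ ∀ τ, T τ q = ((ψ (Multiplicative.ofAdd (a τ)) : ℂ_[p]ˣ) : ℂ_[p]) * q) →
      ∀ τ, (∀ ζ : PadicAlgCl p, (∃ m : ℕ, 0 < m ∧ ¬ p ∣ m ∧ ζ ^ m = 1) → τ ζ = ζ) → a τ = 0) :
    ∀ τ, (∀ ζ : PadicAlgCl p, (∃ m : ℕ, 0 < m ∧ ¬ p ∣ m ∧ ζ ^ m = 1) → τ ζ = ζ) → a τ = 0 := by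
  -- `a` is a homomorphism
  have hmul : ∀ τ₁ τ₂, a (τ₁ * τ₂) = a τ₁ + a τ₂ := by
    intro τ₁ τ₂
    have h12 := twist_mul (hTτ τ₁) (h τ₁) (h τ₂)
    have hT12 : T (τ₁ * τ₂) = (T τ₁).comp (T τ₂) :=
      extension_mul (hT τ₁) (hTτ τ₁) (hT τ₂) (hTτ τ₂) (hT _) (hTτ _)
    have h' : (E.map (PadicComplexInt p).subtype).map (T (τ₁ * τ₂)) =
        ((E.map (PadicComplexInt p).subtype).map (T τ₂)).map (T τ₁) := by
      rw [hT12, map_comp, RingHom.comp_apply]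
    rw [h (τ₁ * τ₂), h12] at h'
    exact (twist_unique hE (hd _) h').2
  -- `a` is continuous
  have hcont : Continuous a := continuous_twistExponent T hT hTτ hE h
  -- the periods, on `E₁ = E / T^{ord E}`
  set E₁ := E.divXPowOrder with hE₁
  have he0 : ((constantCoeff E₁ : 𝓞_ℂ_[p]) : ℂ_[p]) ≠ 0 := by
    intro h0
    have : constantCoeff E₁ = 0 := Subtype.ext h0
    exact hE (constantCoeff_divXPowOrder_eq_zero_iff.1 this)
  have h₁ : ∀ τ, (E₁.map (PadicComplexInt p).subtype).map (T τ) =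
      C (d τ) * ((((binomialSeries ℤ_[p] (a τ)).map (R1.toCpInt p)) * E₁).map
        (PadicComplexInt p).subtype) := fun τ ↦ twist_divXPowOrder (h τ)
  refine hSen a hmul hcont ⟨‖((constantCoeff E₁ : 𝓞_ℂ_[p]) : ℂ_[p])‖, norm_pos_iff.2 he0,
    fun w ψ hψc hψ1 hw ↦ ?_⟩
  have hx1 : ‖algebraMap ℚ_[p] ℂ_[p] w - 1‖ < 1 :=
    hw.trans_le (R1.norm_coe_padicComplexInt_le_one p _)
  obtain ⟨v, hv⟩ := intSeries_exists_hasValueAt E₁ hx1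
  refine ⟨v / ((constantCoeff E₁ : 𝓞_ℂ_[p]) : ℂ_[p]), ?_, fun τ ↦ ?_⟩
  · exact div_ne_zero (twist_period (hT 1) (hTτ 1) (hd 1) (h₁ 1) hw hψc hψ1 hv).1 he0
  · exact (twist_period (hT τ) (hTτ τ) (hd τ) (h₁ τ) hw hψc hψ1 hv).2

end Summit.BirchSwinnertonDyer.Rank1Residual.X11b.Three.RangeTransport
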